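import Mathlib
import Summits.Ventures.PercRepro.TriangleCapThreeRowOneStrict

/-!
# PercRepro — THE SECOND-ORDER LOCUS OF THE ROW `a = 3` AT `r = 1`: for `k ≥ 10`, the non-`3`-bipartite `K₄⁻`-free
graphs with `3 (k − 3) − 1` edges at the second-best value `m k − (k − 2) − 2 (k − 7)` are EXACTLY the hung
`K_{3,k−4}` — a vertex of degree `2` on an edge of `K_{3,k−4}` (p3, gen 45; part 200b)

The degree argument of part 190 tracked at equality, with the pieces of parts 200a/200a′: a vertex `z` of degree `2`
is deleted onto the diagonal `(k − 1, 3, 0)` (part 190's `diag_second_order`) — `D − z = K_{3,k−4}` with the two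
neighbours of `z` in `A′` (`3`-bipartite), both off `A′` (strictly below: `T(z) ≤ 6`), or on opposite sides
(`HungK3`); or `D − z` is `6 (k − 8)` below, strictly (`three_one_del_two`; the neighbours at `≤ k − 4` in `D − z`
since every degree is `≤ k − 3`); a vertex of degree `≤ 1` is strictly below (`three_one_cross_strict`); with
every degree `≥ 3` a vertex at the cap `k − 3` is strictly below (`three_one_cap_strict`) and so is the convexity
(`three_one_convex_strict`). Hence `three_row_one_second_locus`, and on `Fin k` the equivalence
`three_row_one_second_best_maximisers`. (At `k = 8, 9` the census gives the same locus — `3,360` and `7,560` hung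
graphs — but the cap count allows an edge between the two non-neighbours there; not claimed.) Axioms: standard.
-/

namespace PercRepro

namespace TriangleCap

namespace C047

open Finset

variable {V : Type*} [Fintype V] [DecidableEq V]

/-- The arithmetic of the degree-`2` deletion onto `K_{3,k−4}` with both neighbours off the small side: `8 ≤ k`,
`m + 1 = 3 (k − 3)`, `m′ + 2 = m`, `S′ = m′ (k − 1)`, `T ≤ 6` ⇒ strictly below. -/
theorem three_one_del_two_off_arith (k m m' S' T : ℕ) (hk : 8 ≤ k) (hm : m + 1 = 3 * (k - 3)) (hm' : m' + 2 = m)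
    (hS' : S' = m' * (k - 1)) (hT : T ≤ 6) :
    S' + 2 * T + 2 + 2 * 2 + (k - 2) + 2 * (k - 7) + 2 ≤ m * k := by
  obtain ⟨t, rfl⟩ : ∃ t, k = t + 8 := ⟨k - 8, by omega⟩
  have hm1 : m = 3 * t + 14 := by omega
  have hm2 : m' = 3 * t + 12 := by omega
  subst hm1 hm2 hS'
  have e1 : t + 8 - 1 = t + 7 := by omega
  have e2 : t + 8 - 2 = t + 6 := by omega
  have e3 : t + 8 - 7 = t + 1 := by omega
  rw [e1, e2, e3]
  nlinarith [hT]

/-- The arithmetic of the degree-`2` deletion onto a non-`3`-bipartite `D − z`: `9 ≤ k`, `m + 1 = 3 (k − 3)`,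
`m′ + 2 = m`, `S′ + 6 (k − 1 − 7) ≤ m′ (k − 1)`, `T ≤ 2 (k − 4)` ⇒ strictly below. -/
theorem three_one_del_two_gap_arith (k m m' S' T : ℕ) (hk : 9 ≤ k) (hm : m + 1 = 3 * (k - 3)) (hm' : m' + 2 = m)
    (hS' : S' + 6 * (k - 1 - 7) ≤ m' * (k - 1)) (hT : T ≤ 2 * (k - 4)) :
    S' + 2 * T + 2 + 2 * 2 + (k - 2) + 2 * (k - 7) + 2 ≤ m * k := by
  obtain ⟨t, rfl⟩ : ∃ t, k = t + 9 := ⟨k - 9, by omega⟩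
  have hm1 : m = 3 * t + 17 := by omega
  have hm2 : m' = 3 * t + 15 := by omega
  subst hm1 hm2
  have e1 : t + 9 - 1 - 7 = t + 1 := by omega
  have e2 : t + 9 - 1 = t + 8 := by omega
  have e3 : t + 9 - 2 = t + 7 := by omega
  have e4 : t + 9 - 7 = t + 2 := by omega
  have e5 : t + 9 - 4 = t + 5 := by omega
  rw [e1, e2] at hS'
  rw [e5] at hT
  rw [e3, e4]
  nlinarith [hS', hT]

/-- **A VERTEX OF DEGREE `2` ON THE CELL `(k, 3, 1)`, `9 ≤ k`, EVERY DEGREE `≤ k − 3`:** `D − z` lies on the diagonal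
`(k − 1, 3, 0)`; `D` is `3`-bipartite, or a hung `K_{3,k−4}`, or strictly below the second-best value. -/
theorem three_one_del_two (D : SimpleGraph V) [DecidableRel D.Adj] (hK : K4mFree D) (hk : 9 ≤ Fintype.card V)
    (hm : D.edgeFinset.card + 1 = 3 * (Fintype.card V - 3)) (hcap : ∀ v, deg D v + 3 ≤ Fintype.card V) (z : V)
    (hz : deg D z = 2) :
    (∃ A : Finset V, A.card = 3 ∧ BipSub D A) ∨ HungK3 D ∨
      ∑ v, deg D v * deg D v + (Fintype.card V - 2) + 2 * (Fintype.card V - 7) + 2 ≤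
        D.edgeFinset.card * Fintype.card V := by
  have hK' := k4mFree_del D hK z
  have hcard' := card_del z
  have hedges' := card_edges_del D z
  have hsq := sum_deg_sq_del D z
  rw [hz] at hedges' hsq
  obtain ⟨k, hk'⟩ : ∃ k, Fintype.card V = k := ⟨_, rfl⟩
  have hcardW' : Fintype.card {v : V // v ≠ z} = k - 1 := by omega
  obtain ⟨m, hmdef⟩ : ∃ m, D.edgeFinset.card = m := ⟨_, rfl⟩
  obtain ⟨m', hm'def⟩ : ∃ m', (del D z).edgeFinset.card = m' := ⟨_, rfl⟩
  rw [hmdef] at hedges' hm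
  rw [hm'def] at hedges'
  rw [hk'] at hm hk hcap
  have hm' : (del D z).edgeFinset.card + 9 = 3 * Fintype.card {v : V // v ≠ z} := by
    rw [hm'def, hcardW']
    omega
  have hE' : (del D z).edgeFinset.card = 3 * (Fintype.card {v : V // v ≠ z} - 3) := by
    rw [hm'def, hcardW']
    omega
  obtain ⟨T, hTdef⟩ : ∃ T, ∑ w : {v : V // v ≠ z}, (if D.Adj w.1 z then deg (del D z) w else 0) = T := ⟨_, rfl⟩
  obtain ⟨S', hS'def⟩ : ∃ S', ∑ w : {v : V // v ≠ z}, deg (del D z) w * deg (del D z) w = S' := ⟨_, rfl⟩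
  rw [hTdef, hS'def] at hsq
  rcases diag_second_order (del D z) hK' (by omega) hm' with ⟨A', hA'card, hA'⟩ | hgap
  · -- `D − z = K_{3,k−4}`
    by_cases hin : ∀ w : {v : V // v ≠ z}, D.Adj w.1 z → w ∈ A'
    · obtain ⟨B, hBcard, hB⟩ := bipSub_lift D z A' hA' hin
      exact Or.inl ⟨B, by rw [hBcard, hA'card], hB⟩
    push Not at hin
    obtain ⟨w₀, hw₀, hw₀A⟩ := hin
    by_cases hin2 : ∃ w : {v : V // v ≠ z}, D.Adj w.1 z ∧ w ∈ A'
    · obtain ⟨w, hw, hwA⟩ := hin2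
      exact Or.inr (Or.inl ⟨z, A', hz, hA'card, hA', hE', w, w₀, hwA, hw₀A, hw, hw₀⟩)
    · -- every neighbour of `z` is off `A′`: `T(z) ≤ 6`
      right; right
      push Not at hin2
      have hT : T ≤ 6 := by
        rw [← hTdef]
        have h1 : ∑ w : {v : V // v ≠ z}, (if D.Adj w.1 z then deg (del D z) w else 0) ≤
            ∑ w : {v : V // v ≠ z}, (if D.Adj w.1 z then 3 else 0) := by
          apply sum_le_sum
          intro w _
          by_cases h : D.Adj w.1 z
          · simp only [h, if_true]
            have := deg_le_card_of_bipSub (del D z) A' hA' w (hin2 w h)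
            rw [hA'card] at this
            exact this
          · simp only [h, if_false]
            exact le_refl 0
        rw [sum_del_nbhd_const D z 3, hz] at h1
        exact h1
      haveI : Nonempty {v : V // v ≠ z} := Fintype.card_pos_iff.mp (by omega)
      have hS' := sum_deg_sq_eq_of_bipSub_full (del D z) A' 3 hA'card hA' hE' inferInstance
      rw [hS'def, hm'def, hcardW'] at hS'
      rw [hsq, hmdef, hk']
      exact three_one_del_two_off_arith k m m' S' T (by omega) hm hedges' hS' hT
  · right; right
    have hT := sum_del_nbhd_le D z (k - 4) (fun v => by have := hcap v; omega)
    rw [hTdef, hz] at hT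
    rw [hS'def, hm'def, hcardW'] at hgap
    rw [hsq, hmdef, hk']
    exact three_one_del_two_gap_arith k m m' S' T hk hm hedges' hgap hT

/-- **THE SECOND-ORDER LOCUS OF THE ROW `a = 3` AT `r = 1`, `k ≥ 10`:** a `K₄⁻`-free graph with `3 (k − 3) − 1` edges
that is not `3`-bipartite and attains `Σ_v d(v)² + (k − 2) + 2 (k − 7) = m k` is a hung `K_{3,k−4}`. -/
theorem three_row_one_second_locus (D : SimpleGraph V) [DecidableRel D.Adj] (hK : K4mFree D)
    (hk : 10 ≤ Fintype.card V) (hm : D.edgeFinset.card + 1 = 3 * (Fintype.card V - 3))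
    (hnb : ¬ ∃ A : Finset V, A.card = 3 ∧ BipSub D A)
    (heq : ∑ v, deg D v * deg D v + (Fintype.card V - 2) + 2 * (Fintype.card V - 7) =
      D.edgeFinset.card * Fintype.card V) :
    HungK3 D := by
  -- the max-degree cap: every degree is `≤ k − 3`
  have hcap : ∀ v, deg D v + 3 ≤ Fintype.card V := fun v =>
    deg_add_le_card_of_dense D hK 3 (le_refl 3) (by omega)
      (cap_arith 3 (Fintype.card V) D.edgeFinset.card 1 (by omega) (by omega) (by omega)) v
  by_cases hsmall : ∃ z, deg D z ≤ 2
  · obtain ⟨z, hz⟩ := hsmall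
    rcases Nat.lt_or_ge (deg D z) 2 with hz1 | hz2
    · exfalso
      have := three_one_cross_strict D hK hk hm hcap z (by omega)
      omega
    · rcases three_one_del_two D hK (by omega) hm hcap z (by omega) with h | h | h
      · exact absurd h hnb
      · exact h
      · exfalso
        omega
  · push Not at hsmall
    exfalso
    by_cases hx : ∃ x, deg D x + 3 = Fintype.card V
    · obtain ⟨x, hx⟩ := hx
      rcases three_one_cap_strict D hK hk hm (fun v => by have := hsmall v; omega) x hx with h | h
      · exact hnb h
      · omega
    · push Not at hx
      have hcap' : ∀ v, deg D v + 4 ≤ Fintype.card V := fun v => by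
        have h1 := hcap v
        have h2 := hx v
        omega
      have := three_one_convex_strict D (by omega) hm hcap' (fun v => by have := hsmall v; omega)
      omega

/-- **THE SECOND-BEST GRAPHS OF THE CELL `(k, 3, 1)`, `k ≥ 10`, ON `Fin k`:** a non-`3`-bipartite `K₄⁻`-free graph with
`3 (k − 3) − 1` edges attains `Σ_v d(v)² + (k − 2) + 2 (k − 7) = m k` iff it is a hung `K_{3,k−4}`. -/
theorem three_row_one_second_best_maximisers (k : ℕ) (hk : 10 ≤ k) (D : SimpleGraph (Fin k)) [DecidableRel D.Adj]
    (hK : K4mFree D) (hm : D.edgeFinset.card + 1 = 3 * (k - 3))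
    (hnb : ¬ ∃ A : Finset (Fin k), A.card = 3 ∧ BipSub D A) :
    ∑ v, deg D v * deg D v + (k - 2) + 2 * (k - 7) = D.edgeFinset.card * k ↔ HungK3 D := by
  have hcard : Fintype.card (Fin k) = k := Fintype.card_fin k
  constructor
  · intro heq
    exact three_row_one_second_locus D hK (by rw [hcard]; exact hk) (by rw [hcard]; exact hm) hnb
      (by rw [hcard]; exact heq)
  · intro hH
    have := (hungK3_value D (by rw [hcard]; omega) hH).2.1
    rw [hcard] at this
    exact this

end C047

end TriangleCap

end PercRepro
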